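import Literature.MathematicalPhysics.QuantumFieldTheory.Balaban1983to89.B1Eq324BenfattoSect5LedgerDischargeCumulant
import Literature.MathematicalPhysics.QuantumFieldTheory.Balaban1983to89.B1Eq324BenfattoAppendixC2
import HarnessLib

/-!
# Benfatto et al. 1978, §5 — the LEDGER DISCHARGE, UPPER HALF: the closed (4.6) ledger inequality of `…Sect5UpperAssembly.ineq46_of_ledger`
# from ONE free-field threshold, in the socket shape of `…Sect5BasicLemmaKnit.basicLemma_signed_of_ledgers` (UPPERPACK) — PROVED real analysis

doc: Literature/MathematicalPhysics/QuantumFieldTheory/Balaban1983to89/B1Eq324BenfattoLemma.md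

WHY THIS MODULE (cell `pub-ymgap`, seat `dag-n08-c` gen 20; node N08 [Balaban1985UV3]).  `…Sect5BasicLemmaKnit.basicLemma_signed_of_ledgers` proves the
Lemma p. 152 of [BenfattoEtAl1978] (with recorded signs) from ONE displayed hypothesis, the LEDGER SOCKET: for every Appendix-A triple a free-field threshold
`b*` beyond which, for all `t, D, ϰ`, common exponents `ρ₁ … ρ₄` and — separately for the lower and the upper pavement chain — a constant `S ≥ 0`, a rate `δ`
and `b`-dependent pavement parameters `L, w, v` satisfy the side conditions of the assembly theorems and the CLOSED ledger inequality («Collecting all the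
errors made in this process», p. 159).  This file discharges the UPPER half (the (4.6) chain, cut-offs `b/γ^{n+1}`, no Appendix-A term): `upperpack`.  Every
loss of the closed upper ledger is bounded ATOM BY ATOM by the sibling toolkit `…Sect5LedgerDischarge` (per-box `ErrPB` atoms, parameters, normal forms) and
`…Sect5LedgerDischargeCumulant` (cumulant-side and structural atoms) — seat `dag-n08-b` — at the cut-off `c = b/γ^{n+1} ≤ γ^{−(d+1)}·b`, in print's two
regimes (`L = ⌈b²⌉`, `v = ⌈M b^{3/2}⌉`, `w = 2v` for `b ≥ b₀(t,D,ϰ,…)`; `v = 1`, `w = 2` below), and the atoms are summed; the constant `S` is the (closed,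
`s`-uniform) sum of the atoms' constants, recorded only through `∃ S ≥ 0`.
[cite: BenfattoEtAl1978, Basic Lemma (4.6) p.152; §5 (5.36) and «Collecting all the errors» p.159; b* = max{10⁴, γ⁻³b̄} p.159]

## Theorems
* `rate_le_mul`, `one_le_natCeil_sq`, `cutoff_upper`, `params_upper`, `exists_M_upper` — parameter bookkeeping (`⌈b²⌉ ≤ 2b²` is `…ErrTermLedger.natCeil_sq_le_two_mul_sq`).
* `six_errTerm_div_eq`, `three_div_eq`, `err_shape_eq`, `reassoc_b`, `sum_mul_errTerm_eq`, `nsmul_shape_le_errTerm` — the algebra of summing atoms into `nI·errTerm S …`.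
* ★ `upperpack` — UPPERPACK of the ledger socket for all exponents `ρ₁ ≥ D+2d`, `ρ₂ ≥ 0`, `ρ₃ ≥ D+2d`, `ρ₄ ≥ 8·2^d·s₁(D)·γ^{−D(d+1)} + 1` and every
  threshold `b* ≥ 6·2^d(d+1)!·4^{d+1} + 10(d+1) + 2√d + 2`.

HONEST SCOPE.  Elementary real analysis over displayed closed terms; no measure theory; the LOWER half (with the Appendix-A term) is NOT here; count-neutral for N08;
nothing of [Balaban1985UV3] (41)/(47)/(5) is asserted; nothing about d = 4, the continuum, OS axioms, a mass gap or the Clay problem.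
-/

noncomputable section

open Finset
open scoped BigOperators Nat

namespace Literature.MathematicalPhysics.QuantumFieldTheory.Balaban1983to89.B1Eq324BenfattoSect5LedgerDischargeUpper

open Literature.MathematicalPhysics.QuantumFieldTheory.Balaban1983to89.B1Eq324BenfattoLemma
open Literature.MathematicalPhysics.QuantumFieldTheory.Balaban1983to89.B1Eq324BenfattoSect5ErrTermLedger
open Literature.MathematicalPhysics.QuantumFieldTheory.Balaban1983to89.B1Eq324BenfattoSect5Eq511 (s1Const)
open Literature.MathematicalPhysics.QuantumFieldTheory.Balaban1983to89.B1Eq324GaussianMomentLeaf (momentConst)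
open Literature.Probability.LatticeModels (setPartitions)
open Literature.MathematicalPhysics.QuantumFieldTheory.Balaban1983to89.B1Eq324BenfattoSect5LedgerDischarge
open Literature.MathematicalPhysics.QuantumFieldTheory.Balaban1983to89.B1Eq324BenfattoSect5LedgerDischargeCumulant
open Literature.MathematicalPhysics.QuantumFieldTheory.Balaban1983to89.B1Eq324BenfattoAppendixC2 (condCov_freeCov_nonneg_le)

variable {d : ℕ}

/-! ## §1  Parameter bookkeeping -/

section Params

variable {α γ b κ ρ₃ r Q : ℝ}

/-- Rate bookkeeping for the corridor multiplier `M` of p.159: if `M = (ρ₃+1)·Q` with `Q ≥ 1/r`, `r > 0`, `ρ₃ + 1 ≥ 0`, then `ρ₃ + 1 ≤ r·M`.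
[cite: BenfattoEtAl1978, §5 p.159 «corridors … of width ≈ b^{3/2}»] -/
theorem rate_le_mul (hρ : 0 ≤ ρ₃ + 1) (hr : 0 < r) (hQ : r⁻¹ ≤ Q) : ρ₃ + 1 ≤ r * ((ρ₃ + 1) * Q) := by
  have h1 : 1 ≤ r * Q := by
    have := mul_le_mul_of_nonneg_left hQ hr.le
    rwa [mul_inv_cancel₀ hr.ne'] at this
  calc ρ₃ + 1 = (ρ₃ + 1) * 1 := (mul_one _).symm
    _ ≤ (ρ₃ + 1) * (r * Q) := mul_le_mul_of_nonneg_left h1 hρ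
    _ = r * ((ρ₃ + 1) * Q) := by ring

/-- `1 ≤ ⌈b²⌉` for `b ≥ 1`. [cite: BenfattoEtAl1978, p.154] -/
theorem one_le_natCeil_sq (hb : 1 ≤ b) : (1 : ℝ) ≤ ((⌈b ^ 2⌉₊ : ℕ) : ℝ) := by
  have h := natCeil_sq_pos (b := b) hb
  exact_mod_cast h

/-- The cut-offs of the UPPER chain, `c_n = b/γ^{n+1}` (`n ≤ d`), and the next-box cut-off `γ·c_n`, lie in `[b, Γ·b]` with `Γ = γ^{−(d+1)}`.
[cite: BenfattoEtAl1978, p.159 «b replaced by γ⁻¹b»] -/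
theorem cutoff_upper (hγ0 : 0 < γ) (hγ1 : γ ≤ 1) (hb : 1 ≤ b) {n : ℕ} (hn : n ∈ Finset.range (d + 1)) :
    0 ≤ b / γ ^ (n + 1) ∧ b / γ ^ (n + 1) ≤ (γ ^ (d + 1))⁻¹ * b ∧ 1 * b ≤ b / γ ^ (n + 1) ∧
      0 ≤ γ * (b / γ ^ (n + 1)) ∧ γ * (b / γ ^ (n + 1)) ≤ (γ ^ (d + 1))⁻¹ * b := by
  have hb0 : 0 ≤ b := by linarith
  have hnd : n + 1 ≤ d + 1 := by have := Finset.mem_range.mp hn; omega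
  have hp1 : 0 < γ ^ (n + 1) := pow_pos hγ0 _
  have hp2 : 0 < γ ^ (d + 1) := pow_pos hγ0 _
  have hle : γ ^ (d + 1) ≤ γ ^ (n + 1) := pow_le_pow_of_le_one hγ0.le hγ1 hnd
  have hle1 : γ ^ (n + 1) ≤ 1 := pow_le_one₀ hγ0.le hγ1
  have hinv : (γ ^ (n + 1))⁻¹ ≤ (γ ^ (d + 1))⁻¹ := inv_anti₀ hp2 hle
  have h2 : b / γ ^ (n + 1) ≤ (γ ^ (d + 1))⁻¹ * b := by
    rw [div_eq_mul_inv, mul_comm]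
    exact mul_le_mul_of_nonneg_right hinv hb0
  have h0 : 0 ≤ b / γ ^ (n + 1) := by positivity
  refine ⟨h0, h2, ?_, by positivity, (mul_le_of_le_one_left h0 hγ1).trans h2⟩
  rw [one_mul, le_div_iff₀ hp1]
  exact mul_le_of_le_one_right hb0 hle1

/-- The `b`-dependent pavement parameters of the upper chain in print's two regimes: `L = ⌈b²⌉`, `v = V` with `V = ⌈M b^{3/2}⌉` for `b ≥ b₀` and `V = 1`
below, `w = 2V`; every side condition of `ineq46_of_ledger` from `b > 6·2^d(d+1)!·4^{d+1} + 10(d+1) + 2√d + 2` and `b₀ ≥ (10(d+1)(M+1))²`.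
[cite: BenfattoEtAl1978, p.154 (ℓ ≈ b²), p.159 (b*)] -/
theorem params_upper {M b₀ : ℝ} (hM : 0 < M) (hb₀ : (10 * ((d : ℝ) + 1) * (M + 1)) ^ 2 ≤ b₀)
    (hb : 6 * 2 ^ d * ((d + 1).factorial : ℝ) * (4 / 1 ^ 2) ^ (d + 1) + 10 * (d + 1) + 2 * Real.sqrt d + 2 < b) :
    ∃ L V : ℕ, 1 ≤ b ∧ ((L : ℝ) ≤ 2 * b ^ 2) ∧ (1 ≤ (L : ℝ)) ∧ ((L : ℝ) ^ d) * Real.exp (-(b ^ 2 / 4)) ≤ 1 / 6 ∧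
      Real.sqrt d * ((L : ℝ) - 1) < b ^ 3 ∧ 1 ≤ V ∧ (b₀ ≤ b → M * b ^ (3 / 2 : ℝ) ≤ (V : ℝ)) ∧
      (d + 1) * (2 * (2 * (2 * V) + V)) ≤ L := by
  have hsq : 0 ≤ Real.sqrt d := Real.sqrt_nonneg _
  have hfac : (1 : ℝ) ≤ ((d + 1).factorial : ℝ) := by exact_mod_cast Nat.succ_le_of_lt (Nat.factorial_pos _)
  have h41 : (4 : ℝ) / 1 ^ 2 = 4 := by norm_num
  have hA : (1 : ℝ) ≤ 6 * 2 ^ d * ((d + 1).factorial : ℝ) * (4 / 1 ^ 2) ^ (d + 1) := by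
    rw [h41]
    have h2 : (1 : ℝ) ≤ 2 ^ d := one_le_pow₀ (by norm_num)
    have h4 : (1 : ℝ) ≤ 4 ^ (d + 1) := one_le_pow₀ (by norm_num)
    nlinarith [mul_le_mul h2 hfac zero_le_one (by positivity), mul_le_mul (mul_le_mul h2 hfac zero_le_one (by positivity)) h4 zero_le_one (by positivity)]
  have hb1 : 1 ≤ b := by nlinarith
  have hb0' : 0 ≤ b := by linarith
  have hbb : b ≤ b ^ 2 := by nlinarith
  have hthr : 6 * 2 ^ d * ((d + 1).factorial : ℝ) * (4 / 1 ^ 2) ^ (d + 1) ≤ b ^ 2 := by nlinarith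
  have h10 : 10 * ((d : ℝ) + 1) ≤ b ^ 2 := by nlinarith
  have hfar : 2 * Real.sqrt d < b := by nlinarith
  refine ⟨⌈b ^ 2⌉₊, (if b₀ ≤ b then ⌈M * b ^ (3 / 2 : ℝ)⌉₊ else 1), hb1, natCeil_sq_le_two_mul_sq hb1, one_le_natCeil_sq hb1, ?_,
    sqrt_mul_natCeil_sq_lt_cube hb1 hfar, one_le_regimeV hM hb1, fun h => wide_of_regime h, shifts_fit_regime hM.le hb₀ h10⟩
  have h := natCeil_sq_pow_mul_exp_le (d := d) (b := b) (c := b) (γ' := 1) one_pos hb1 (by rw [one_mul]) hthr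
  exact h

/-- The corridor multiplier `M` of the wide regime dominating every decay rate of the expansion: `ρ₃ + 1 ≤ r·M` for `r ∈ {ϰ/4, ϰ′/2, δ/2, log((2d+α²)/2d)}` and
`r = δ/(4(k+1))`, `k < t`. [cite: BenfattoEtAl1978, p.159 «corridors of width ≈ b^{3/2}»] -/
theorem exists_M_upper {κ' δ L₀ : ℝ} (hρ : 0 ≤ ρ₃ + 1) (hκ : 0 < κ) (hκ' : 0 < κ') (hδ : 0 < δ) (hL₀ : 0 < L₀) (t : ℕ) :
    ∃ M : ℝ, 0 < M ∧ ρ₃ + 1 ≤ κ / 4 * M ∧ ρ₃ + 1 ≤ κ' / 2 * M ∧ ρ₃ + 1 ≤ δ / 2 * M ∧ ρ₃ + 1 ≤ L₀ * M ∧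
      ∀ k : ℕ, k < t → ρ₃ + 1 ≤ δ / (2 * ((k + 1 : ℕ) : ℝ)) / 2 * M := by
  set Q : ℝ := (κ / 4)⁻¹ + (κ' / 2)⁻¹ + (δ / 2)⁻¹ + L₀⁻¹ + 4 * t / δ + 1 with hQ
  have hq1 : 0 < (κ / 4)⁻¹ := by positivity
  have hq2 : 0 < (κ' / 2)⁻¹ := by positivity
  have hq3 : 0 < (δ / 2)⁻¹ := by positivity
  have hq4 : 0 < L₀⁻¹ := by positivity
  have hq5 : 0 ≤ 4 * (t : ℝ) / δ := by positivity
  have hQpos : 0 < Q := by rw [hQ]; linarith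
  refine ⟨(ρ₃ + 1) * Q + 1, by positivity, ?_, ?_, ?_, ?_, fun k hk => ?_⟩
  · have h := rate_le_mul hρ (by positivity : 0 < κ / 4) (show (κ / 4)⁻¹ ≤ Q by rw [hQ]; linarith)
    nlinarith [hκ]
  · have h := rate_le_mul hρ (by positivity : 0 < κ' / 2) (show (κ' / 2)⁻¹ ≤ Q by rw [hQ]; linarith)
    nlinarith [hκ']
  · have h := rate_le_mul hρ (by positivity : 0 < δ / 2) (show (δ / 2)⁻¹ ≤ Q by rw [hQ]; linarith)
    nlinarith [hδ]
  · have h := rate_le_mul hρ hL₀ (show L₀⁻¹ ≤ Q by rw [hQ]; linarith)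
    nlinarith [hL₀]
  · have hk1 : 0 < ((k + 1 : ℕ) : ℝ) := by positivity
    have hr : 0 < δ / (2 * ((k + 1 : ℕ) : ℝ)) / 2 := by positivity
    have hkt : ((k + 1 : ℕ) : ℝ) ≤ t := by exact_mod_cast hk
    have hinv : (δ / (2 * ((k + 1 : ℕ) : ℝ)) / 2)⁻¹ ≤ Q := by
      have h1 : (δ / (2 * ((k + 1 : ℕ) : ℝ)) / 2)⁻¹ = 4 * ((k + 1 : ℕ) : ℝ) / δ := by
        field_simp
        ring
      rw [h1, hQ]
      have h2 : 4 * ((k + 1 : ℕ) : ℝ) / δ ≤ 4 * t / δ := by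
        apply div_le_div_of_nonneg_right _ hδ.le
        linarith
      linarith
    have h := rate_le_mul hρ hr hinv
    nlinarith [hr]

end Params

/-! ## §2  The algebra of summing atoms into `nI·errTerm S ρ₁ ρ₂ ρ₃ ρ₄ A b t` -/

section Algebra

/-- Six atoms `nI·errTerm Cᵢ …` over a common denominator, grouped `((a + b) + (c + d)) + e + f` as in the closed cumulant side of
`…Sect5StepBound.exists_upper_step`: `(Σᵢ nI·errTerm Cᵢ)/f = nI·errTerm ((Σᵢ Cᵢ)/f)`. [cite: BenfattoEtAl1978, (4.6)–(4.7) p.152] -/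
theorem six_errTerm_div_eq (nI Ca Cb Cc Cd Ce Cf f ρ₁ ρ₂ ρ₃ ρ₄ A b : ℝ) (t : ℕ) :
    (nI * errTerm Ca ρ₁ ρ₂ ρ₃ ρ₄ A b t + nI * errTerm Cb ρ₁ ρ₂ ρ₃ ρ₄ A b t + (nI * errTerm Cc ρ₁ ρ₂ ρ₃ ρ₄ A b t +
        nI * errTerm Cd ρ₁ ρ₂ ρ₃ ρ₄ A b t) + nI * errTerm Ce ρ₁ ρ₂ ρ₃ ρ₄ A b t + nI * errTerm Cf ρ₁ ρ₂ ρ₃ ρ₄ A b t) / f =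
      nI * errTerm ((Ca + Cb + Cc + Cd + Ce + Cf) / f) ρ₁ ρ₂ ρ₃ ρ₄ A b t := by
  simp only [errTerm]
  ring

/-- Three per-box atoms of the closed ledger over a common denominator `(k+1)!` («Collecting all the errors», p.159). [cite: BenfattoEtAl1978, §5 p.159, (4.6)–(4.7) p.152] -/
theorem three_div_eq (SND Ce a x y a' x' z f : ℝ) :
    (Ce * SND + a * (x * SND + y * SND) + a' * (x' * SND + z * SND)) / f = (Ce + a * (x + y) + a' * (x' + z)) / f * SND := by
  ring

/-- Regrouping the per-box error of the closed ledger: `Cr·FST + Cv·SND + T·SND = Cr·FST + (Cv + T)·SND` («Collecting all the errors», p.159).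
[cite: BenfattoEtAl1978, §5 p.159, (4.6)–(4.7) p.152] -/
theorem err_shape_eq (Cr FST Cv SND T : ℝ) : Cr * FST + Cv * SND + T * SND = Cr * FST + (Cv + T) * SND := by
  ring

/-- Re-association of the (5.34)-type cumulant atom: the closed ledger writes `nI·(X·L^d·Σ)`, the atom `nI·X·L^d·Σ`. [cite: BenfattoEtAl1978, (5.34) p.158, §5 p.159] -/
theorem reassoc_b {P nI X Ld Sg G C : ℝ} (h : P * (nI * X * Ld * Sg) * G ≤ C) : P * (nI * (X * Ld * Sg)) * G ≤ C := by
  have e : nI * (X * Ld * Sg) = nI * X * Ld * Sg := by ring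
  rw [e]
  exact h

/-- `Σ_k nI·errTerm (g_k) … = nI·errTerm (Σ_k g_k) …`. [cite: BenfattoEtAl1978, §5 p.159] -/
theorem sum_mul_errTerm_eq {ι : Type*} (s : Finset ι) (g : ι → ℝ) (nI ρ₁ ρ₂ ρ₃ ρ₄ A b : ℝ) (t : ℕ) :
    ∑ k ∈ s, nI * errTerm (g k) ρ₁ ρ₂ ρ₃ ρ₄ A b t = nI * errTerm (∑ k ∈ s, g k) ρ₁ ρ₂ ρ₃ ρ₄ A b t := by
  simp only [errTerm]
  rw [Finset.sum_mul, Finset.mul_sum]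

/-- The final fold: `m` equal per-step totals `nI·errTerm C₁ + nI·errTerm C₂ + (nI·(Cr·FST + Ce·SND) + nI·errTerm Cc)` are at most `nI·errTerm X …`
with `X = max (max (m(C₁+C₂+Cc+Ce)) (m(C₁+C₂+Cc+Cr))) 0` — no sign information on the `C`'s is needed. [cite: BenfattoEtAl1978, (4.6)–(4.7) p.152] -/
theorem nsmul_shape_le_errTerm {m : ℕ} {nI C₁ C₂ Cr Ce Cc A b ρ₁ ρ₂ ρ₃ ρ₄ : ℝ} {t : ℕ} (hnI : 0 ≤ nI) (hA : 0 ≤ A) (hb : 0 ≤ b) :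
    m • (nI * errTerm C₁ ρ₁ ρ₂ ρ₃ ρ₄ A b t + nI * errTerm C₂ ρ₁ ρ₂ ρ₃ ρ₄ A b t +
        (nI * (Cr * (A * b ^ ρ₁ * Real.exp (ρ₂ * A * b ^ ρ₃)) ^ (t + 1) + Ce * (Real.exp (-(ρ₃ * b ^ (3 / 2 : ℝ))) * Real.exp (ρ₄ * A * b ^ ρ₃))) +
          nI * errTerm Cc ρ₁ ρ₂ ρ₃ ρ₄ A b t)) ≤
      nI * errTerm (max (max ((m : ℝ) * (C₁ + C₂ + Cc + Ce)) ((m : ℝ) * (C₁ + C₂ + Cc + Cr))) 0) ρ₁ ρ₂ ρ₃ ρ₄ A b t := by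
  rw [nsmul_eq_mul]
  unfold errTerm
  set F : ℝ := (A * b ^ ρ₁ * Real.exp (ρ₂ * A * b ^ ρ₃)) ^ (t + 1) with hF
  set S : ℝ := Real.exp (-(ρ₃ * b ^ (3 / 2 : ℝ))) * Real.exp (ρ₄ * A * b ^ ρ₃) with hS
  set X : ℝ := max (max ((m : ℝ) * (C₁ + C₂ + Cc + Ce)) ((m : ℝ) * (C₁ + C₂ + Cc + Cr))) 0 with hX
  have hF0 : 0 ≤ F := by rw [hF]; positivity
  have hS0 : 0 ≤ S := by rw [hS]; positivity
  have hP : (m : ℝ) * (C₁ + C₂ + Cc + Ce) ≤ X := (le_max_left _ _).trans (le_max_left _ _)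
  have hR : (m : ℝ) * (C₁ + C₂ + Cc + Cr) ≤ X := (le_max_right _ _).trans (le_max_left _ _)
  have heq : (m : ℝ) * (nI * (C₁ * (F + S)) + nI * (C₂ * (F + S)) + (nI * (Cr * F + Ce * S) + nI * (Cc * (F + S)))) =
      nI * ((m : ℝ) * (C₁ + C₂ + Cc + Ce) * S + (m : ℝ) * (C₁ + C₂ + Cc + Cr) * F) := by ring
  rw [heq]
  refine mul_le_mul_of_nonneg_left ?_ hnI
  calc (m : ℝ) * (C₁ + C₂ + Cc + Ce) * S + (m : ℝ) * (C₁ + C₂ + Cc + Cr) * F ≤ X * S + X * F :=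
        add_le_add (mul_le_mul_of_nonneg_right hP hS0) (mul_le_mul_of_nonneg_right hR hF0)
    _ = X * (F + S) := by ring

end Algebra

/-! ## §3  UPPERPACK: the closed (4.6) ledger of `ineq46_of_ledger` from one free-field threshold -/

section Upper

variable {α β : ℝ}

set_option maxHeartbeats 1600000 in -- the conclusion is the ≈ 90-line closed ledger text of `…Sect5UpperAssembly.ineq46_of_ledger`; ≈ 15 atoms per (n, k)
/-- ★ **UPPERPACK — the UPPER half of the ledger socket of `…Sect5BasicLemmaKnit.basicLemma_signed_of_ledgers`, DISCHARGED.**  For `d ≥ 1`, `α, β > 0`, a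
contraction `0 < γ ≤ 1`, every `t, D`, `ϰ > 0`, all exponents with `ρ₁ ≥ D + 2d`, `ρ₂ ≥ 0`, `ρ₃ ≥ D + 2d`, `ρ₄ ≥ 8·2^d·s₁(D)·γ^{−D(d+1)} + 1` and every threshold
`b* ≥ 6·2^d(d+1)!·4^{d+1} + 10(d+1) + 2√d + 2` (free of `t, D, ϰ`): there are `S ≥ 0` and a rate `0 < δ ≤ log((2d+α²)/2d)` with `δD²√d < ϰ` such that every `b > b*`
admits pavement parameters `L, w, v` (`L = ⌈b²⌉`, `w = 2v`, `v = ⌈Mb^{3/2}⌉` resp. `1`) with `2(2w+v) < L`, `(d+1)·2(2w+v) ≤ L`, `v ≤ w`, `1 ≤ w`, `1 ≤ b`,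
`L^d e^{−b²/4} ≤ 1/6`, `√d(L−1) < b³`, and — for all `s`, `nI ≥ 1`, `A ≥ 0` — the closed UPPER ledger inequality of `ineq46_of_ledger` (its `hledger` with
`|I| ↦ nI`, `sup|coeff| ↦ A`) `≤ nI·errTerm S ρ₁ ρ₂ ρ₃ ρ₄ A b t`.  Proof: `params_upper` / `exists_M_upper` for the parameters; every atom of the ledger at the cut-off
`c = b/γ^{n+1} ∈ [b, γ^{−(d+1)}b]` by `…LedgerDischarge.errPB_*` / `…LedgerDischargeCumulant.cum_*`, `struct*`; summed by §2.
[cite: BenfattoEtAl1978, Basic Lemma (4.6) p.152; §5 (5.36), «Collecting all the errors» p.159] -/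
theorem upperpack (hd : 0 < d) (hα : 0 < α) (hβ : 0 < β) {γ : ℝ} (hγ0 : 0 < γ) (hγ1 : γ ≤ 1)
    (t D : ℕ) {κ : ℝ} (hκ : 0 < κ) {ρ₁ ρ₂ ρ₃ ρ₄ : ℝ}
    (hρ₁ : (D : ℝ) + 2 * d ≤ ρ₁) (hρ₂ : 0 ≤ ρ₂) (hρ₃ : (D : ℝ) + 2 * d ≤ ρ₃)
    (hρ₄ : 8 * s1Const D D d κ * (γ ^ (d + 1))⁻¹ ^ D * 2 ^ d + 1 ≤ ρ₄)
    {bstar : ℝ} (hbs : 6 * 2 ^ d * ((d + 1).factorial : ℝ) * (4 / 1 ^ 2) ^ (d + 1) + 10 * (d + 1) + 2 * Real.sqrt d + 2 ≤ bstar) :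
    ∃ S δ : ℝ, 0 ≤ S ∧ 0 < δ ∧ δ ≤ Real.log ((2 * d + α ^ 2) / (2 * d)) ∧ 0 < κ / 2 - δ / 2 * ((D : ℝ) ^ 2 * Real.sqrt d) ∧
      ∀ b : ℝ, bstar < b → ∃ L w v : ℕ, 2 * (2 * w + v) < L ∧ (d + 1) * (2 * (2 * w + v)) ≤ L ∧ v ≤ w ∧ 1 ≤ w ∧
        1 ≤ b ∧ ((L : ℝ) ^ d) * Real.exp (-(b ^ 2 / 4)) ≤ 1 / 6 ∧ Real.sqrt d * ((L : ℝ) - 1) < b ^ 3 ∧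
        ∀ (s : ℕ) (nI A : ℝ), 1 ≤ nI → 0 ≤ A →
          ∑ n ∈ Finset.range (d + 1),
              (((s1Const s D d κ * A * (γ * (b / γ ^ (n + 1))) ^ D * Real.exp (-(κ / 4 * w)) * nI
                + s1Const s D d κ * A * (b / γ ^ (n + 1)) ^ D *
                  (Real.exp (-(κ / 4 * w)) * (nI * (L : ℝ) ^ d) + Real.exp (-(κ / 4 * v)) * (nI * (L : ℝ) ^ d))) : ℝ)
                + (nI * ((let M : ℝ := A * (L : ℝ) ^ d * ∑ p ∈ Finset.Icc 1 s, ((admissible p D).card : ℝ) *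
                  ((2 / (1 - Real.exp (-(κ / 2 / (p : ℕ) / Real.sqrt d))) * Real.exp (κ / 2 / (p : ℕ) / Real.sqrt d)) ^ d) ^ (p - 1)
              let Mt : ℝ := A * Real.exp (δ / 2 * ((D : ℝ) ^ 2 * d)) * (L : ℝ) ^ d * ∑ p ∈ Finset.Icc 1 s, ((admissible p D).card : ℝ) *
                  ((2 / (1 - Real.exp (-((κ / 2 - δ / 2 * ((D : ℝ) ^ 2 * Real.sqrt d)) / (p : ℕ) / Real.sqrt d))) *
                    Real.exp ((κ / 2 - δ / 2 * ((D : ℝ) ^ 2 * Real.sqrt d)) / (p : ℕ) / Real.sqrt d)) ^ d) ^ (p - 1)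
              let K : ℝ := 4 * (s1Const s D d κ * A * (b / γ ^ (n + 1)) ^ D * (L : ℝ) ^ d)
              let ε : ℝ := s1Const s D d κ * A * (b / γ ^ (n + 1)) ^ D * Real.exp (-(κ / 4 * v)) * (L : ℝ) ^ d
              let W : ℝ := 3 * (((L : ℝ) ^ d) * Real.exp (-((b / γ ^ (n + 1)) ^ 2 / 4)))
              let cχ : ℕ → ℝ := fun k => 2 ^ k * ((∑ π ∈ setPartitions (univ : Finset (Fin k)), ((π.card - 1)! : ℝ)) *
                  ((min 1 (2 * ((L : ℝ) ^ d) * Real.exp (-((b / γ ^ (n + 1)) ^ 2 / 4)))) ^ ((2 * k : ℕ) : ℝ)⁻¹ *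
                    ((1 + (1 + 2 * d / α ^ 2) * (γ * (b / γ ^ (n + 1)))) ^ D * M * momentConst D (2 * k) (freeCov d α β 0 0).toNNReal) ^ k))
              let K₀ : ℝ := max (max 1 (freeCov d α β 0 0)) ((1 + 2 * d / α ^ 2) * (γ * (b / γ ^ (n + 1))))
              let ε₃₁ : ℝ := max (β * (2 * d * (freeCov d α β 0 0 * (2 * d / (2 * d + α ^ 2)) ^ (w - v))) *
                    (γ * (b / γ ^ (n + 1)) * ((L : ℝ) ^ d * (1 + Real.sqrt d * ((L : ℝ) - 1)))))
                  (2 * d * freeCov d α β 0 0 * (2 * d / (2 * d + α ^ 2)) ^ (w - v) / α ^ 2)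
              let δ₂₉ : ℕ → ℝ := fun k => 2 ^ (k * D) * 2 ^ 2 ^ (k * D) * K₀ ^ (k * D) * Real.exp (-(δ / 2 * ((v : ℝ) + 1))) * Mt ^ k
              let δ₃₁ : ℕ → ℝ := fun k => M ^ k * (2 ^ (k * D) * 2 ^ 2 ^ (k * D) * ((k * D : ℕ) * K₀ ^ (k * D) * ε₃₁))
              let Err : ℝ := 2 * (2 ^ ((t + 1).choose 2) * K ^ (t + 1) / (t + 1)!) + Real.exp (2 * K) * W
                  + ∑ k ∈ Finset.range t,
                      (3 ^ (k + 1) * ((∑ π ∈ setPartitions (univ : Finset (Fin (k + 1))), ((π.card - 1)! : ℝ)) * (ε * K ^ k))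
                        + 3 ^ (k + 1) * (cχ (k + 1) + δ₂₉ (k + 1)) + 3 ^ (k + 1) * (cχ (k + 1) + δ₃₁ (k + 1))) / (k + 1)!
              Err) : ℝ)
                + (            ∑ k ∈ Finset.range t,
                ((2 ^ (k + 1) * (2 ^ ((k + 1) * D) * 2 ^ 2 ^ ((k + 1) * D) * (max 1 (freeCov d α β 0 0)) ^ ((k + 1) * D)) *
                ((A * Real.exp (δ / 2 * ((D : ℝ) ^ 2 * d)) *
                    Real.exp (-((κ / 2 - δ / 2 * ((D : ℝ) ^ 2 * Real.sqrt d)) / 2 * w))) * nI *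
                  ∑ p ∈ Finset.Icc 1 s, ((admissible p D).card : ℝ) *
                    ((2 / (1 - Real.exp (-((κ / 2 - δ / 2 * ((D : ℝ) ^ 2 * Real.sqrt d)) / 2 / (p : ℕ) / Real.sqrt d))) *
                      Real.exp ((κ / 2 - δ / 2 * ((D : ℝ) ^ 2 * Real.sqrt d)) / 2 / (p : ℕ) / Real.sqrt d)) ^ d) ^ (p - 1)) *
                (A * Real.exp (δ / 2 * ((D : ℝ) ^ 2 * d)) *
                  ((1 : ℝ) * (2 / (1 - Real.exp (-(δ / (2 * ((k + 1 : ℕ) : ℝ)) / Real.sqrt d))) * Real.exp (δ / (2 * ((k + 1 : ℕ) : ℝ)) / Real.sqrt d)) ^ d) *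
                  ∑ p ∈ Finset.Icc 1 s, ((admissible p D).card : ℝ) *
                    ((2 / (1 - Real.exp (-((κ / 2 - δ / 2 * ((D : ℝ) ^ 2 * Real.sqrt d)) / (p : ℕ) / Real.sqrt d))) *
                      Real.exp ((κ / 2 - δ / 2 * ((D : ℝ) ^ 2 * Real.sqrt d)) / (p : ℕ) / Real.sqrt d)) ^ d) ^ (p - 1)) ^ k
                + 2 ^ (k + 1) * (2 ^ ((k + 1) * D) * 2 ^ 2 ^ ((k + 1) * D) * (max 1 (freeCov d α β 0 0)) ^ ((k + 1) * D)) *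
              (nI * (A * Real.exp (δ / 2 * ((D : ℝ) ^ 2 * d)) * Real.exp (-((κ / 2 - δ / 2 * ((D : ℝ) ^ 2 * Real.sqrt d)) / 2 * v)) *
                (L : ℝ) ^ d * ∑ p ∈ Finset.Icc 1 s, ((admissible p D).card : ℝ) *
                    ((2 / (1 - Real.exp (-((κ / 2 - δ / 2 * ((D : ℝ) ^ 2 * Real.sqrt d)) / 2 / (p : ℕ) / Real.sqrt d))) *
                      Real.exp ((κ / 2 - δ / 2 * ((D : ℝ) ^ 2 * Real.sqrt d)) / 2 / (p : ℕ) / Real.sqrt d)) ^ d) ^ (p - 1))) *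
              (A * Real.exp (δ / 2 * ((D : ℝ) ^ 2 * d)) *
                (2 / (1 - Real.exp (-(δ / (2 * ((k + 1 : ℕ) : ℝ)) / Real.sqrt d))) * Real.exp (δ / (2 * ((k + 1 : ℕ) : ℝ)) / Real.sqrt d)) ^ d *
                ∑ p ∈ Finset.Icc 1 s, ((admissible p D).card : ℝ) *
                    ((2 / (1 - Real.exp (-((κ / 2 - δ / 2 * ((D : ℝ) ^ 2 * Real.sqrt d)) / (p : ℕ) / Real.sqrt d))) *
                      Real.exp ((κ / 2 - δ / 2 * ((D : ℝ) ^ 2 * Real.sqrt d)) / (p : ℕ) / Real.sqrt d)) ^ d) ^ (p - 1)) ^ k)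
                + (2 ^ (k + 1) * (2 ^ ((k + 1) * D) * 2 ^ 2 ^ ((k + 1) * D) * (max 1 (freeCov d α β 0 0)) ^ ((k + 1) * D)) *
                (A * Real.exp (δ / 2 * ((D : ℝ) ^ 2 * d)) * Real.exp (-((κ / 2 - δ / 2 * ((D : ℝ) ^ 2 * Real.sqrt d)) / 2 * w)) *
                  (nI * (L : ℝ) ^ d) * ∑ p ∈ Finset.Icc 1 s, ((admissible p D).card : ℝ) *
                    ((2 / (1 - Real.exp (-((κ / 2 - δ / 2 * ((D : ℝ) ^ 2 * Real.sqrt d)) / 2 / (p : ℕ) / Real.sqrt d))) *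
                      Real.exp ((κ / 2 - δ / 2 * ((D : ℝ) ^ 2 * Real.sqrt d)) / 2 / (p : ℕ) / Real.sqrt d)) ^ d) ^ (p - 1)) *
                (A * Real.exp (δ / 2 * ((D : ℝ) ^ 2 * d)) *
                  (2 / (1 - Real.exp (-(δ / (2 * ((k + 1 : ℕ) : ℝ)) / Real.sqrt d))) * Real.exp (δ / (2 * ((k + 1 : ℕ) : ℝ)) / Real.sqrt d)) ^ d *
                  ∑ p ∈ Finset.Icc 1 s, ((admissible p D).card : ℝ) *
                    ((2 / (1 - Real.exp (-((κ / 2 - δ / 2 * ((D : ℝ) ^ 2 * Real.sqrt d)) / (p : ℕ) / Real.sqrt d))) *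
                      Real.exp ((κ / 2 - δ / 2 * ((D : ℝ) ^ 2 * Real.sqrt d)) / (p : ℕ) / Real.sqrt d)) ^ d) ^ (p - 1)) ^ k
                + 2 ^ (k + 1) * (2 ^ ((k + 1) * D) * 2 ^ 2 ^ ((k + 1) * D) * (max 1 (freeCov d α β 0 0)) ^ ((k + 1) * D)) *
              (nI * (A * Real.exp (δ / 2 * ((D : ℝ) ^ 2 * d)) * Real.exp (-((κ / 2 - δ / 2 * ((D : ℝ) ^ 2 * Real.sqrt d)) / 2 * v)) *
                (L : ℝ) ^ d * ∑ p ∈ Finset.Icc 1 s, ((admissible p D).card : ℝ) *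
                    ((2 / (1 - Real.exp (-((κ / 2 - δ / 2 * ((D : ℝ) ^ 2 * Real.sqrt d)) / 2 / (p : ℕ) / Real.sqrt d))) *
                      Real.exp ((κ / 2 - δ / 2 * ((D : ℝ) ^ 2 * Real.sqrt d)) / 2 / (p : ℕ) / Real.sqrt d)) ^ d) ^ (p - 1))) *
              (A * Real.exp (δ / 2 * ((D : ℝ) ^ 2 * d)) *
                (2 / (1 - Real.exp (-(δ / (2 * ((k + 1 : ℕ) : ℝ)) / Real.sqrt d))) * Real.exp (δ / (2 * ((k + 1 : ℕ) : ℝ)) / Real.sqrt d)) ^ d *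
                ∑ p ∈ Finset.Icc 1 s, ((admissible p D).card : ℝ) *
                    ((2 / (1 - Real.exp (-((κ / 2 - δ / 2 * ((D : ℝ) ^ 2 * Real.sqrt d)) / (p : ℕ) / Real.sqrt d))) *
                      Real.exp ((κ / 2 - δ / 2 * ((D : ℝ) ^ 2 * Real.sqrt d)) / (p : ℕ) / Real.sqrt d)) ^ d) ^ (p - 1)) ^ k)
                + 2 ^ ((k + 1) * D) * 2 ^ 2 ^ ((k + 1) * D) * (max 1 (freeCov d α β 0 0)) ^ ((k + 1) * D) *
              (nI * (((k + 1 : ℕ) : ℝ) * (k : ℝ) *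
                ((A * Real.exp (δ / 2 * ((D : ℝ) ^ 2 * d)) * ((L : ℝ) ^ d * (2 / (1 - Real.exp (-(δ / (2 * ((k + 1 : ℕ) : ℝ)) / Real.sqrt d))) * Real.exp (δ / (2 * ((k + 1 : ℕ) : ℝ)) / Real.sqrt d)) ^ d) *
                    ∑ p ∈ Finset.Icc 1 s, ((admissible p D).card : ℝ) *
                    ((2 / (1 - Real.exp (-((κ / 2 - δ / 2 * ((D : ℝ) ^ 2 * Real.sqrt d)) / (p : ℕ) / Real.sqrt d))) *
                      Real.exp ((κ / 2 - δ / 2 * ((D : ℝ) ^ 2 * Real.sqrt d)) / (p : ℕ) / Real.sqrt d)) ^ d) ^ (p - 1)) * ((A * Real.exp (δ / 2 * ((D : ℝ) ^ 2 * d)) * Real.exp (-(δ / (2 * ((k + 1 : ℕ) : ℝ)) / 2 * ((w : ℝ) + v + 1))) * ((L : ℝ) ^ d * (2 / (1 - Real.exp (-(δ / (2 * ((k + 1 : ℕ) : ℝ)) / 2 / Real.sqrt d))) * Real.exp (δ / (2 * ((k + 1 : ℕ) : ℝ)) / 2 / Real.sqrt d)) ^ d) *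
                    ∑ p ∈ Finset.Icc 1 s, ((admissible p D).card : ℝ) *
                    ((2 / (1 - Real.exp (-((κ / 2 - δ / 2 * ((D : ℝ) ^ 2 * Real.sqrt d)) / (p : ℕ) / Real.sqrt d))) *
                      Real.exp ((κ / 2 - δ / 2 * ((D : ℝ) ^ 2 * Real.sqrt d)) / (p : ℕ) / Real.sqrt d)) ^ d) ^ (p - 1)) *
                   (A * Real.exp (δ / 2 * ((D : ℝ) ^ 2 * d)) * ((L : ℝ) ^ d * (2 / (1 - Real.exp (-(δ / (2 * ((k + 1 : ℕ) : ℝ)) / Real.sqrt d))) * Real.exp (δ / (2 * ((k + 1 : ℕ) : ℝ)) / Real.sqrt d)) ^ d) *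
                    ∑ p ∈ Finset.Icc 1 s, ((admissible p D).card : ℝ) *
                    ((2 / (1 - Real.exp (-((κ / 2 - δ / 2 * ((D : ℝ) ^ 2 * Real.sqrt d)) / (p : ℕ) / Real.sqrt d))) *
                      Real.exp ((κ / 2 - δ / 2 * ((D : ℝ) ^ 2 * Real.sqrt d)) / (p : ℕ) / Real.sqrt d)) ^ d) ^ (p - 1)) ^ (k - 1)))))
                + nI * ((3 : ℝ) ^ (k + 1) *
              (2 ^ ((k + 1) * D) * 2 ^ 2 ^ ((k + 1) * D) * (max 1 (freeCov d α β 0 0)) ^ ((k + 1) * D) *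
                  Real.exp (-(δ / 2 * ((v : ℝ) + 1))) *
                (A * Real.exp (δ / 2 * ((D : ℝ) ^ 2 * d)) * (L : ℝ) ^ d * ∑ p ∈ Finset.Icc 1 s, ((admissible p D).card : ℝ) *
                    ((2 / (1 - Real.exp (-((κ / 2 - δ / 2 * ((D : ℝ) ^ 2 * Real.sqrt d)) / (p : ℕ) / Real.sqrt d))) *
                      Real.exp ((κ / 2 - δ / 2 * ((D : ℝ) ^ 2 * Real.sqrt d)) / (p : ℕ) / Real.sqrt d)) ^ d) ^ (p - 1)) ^ (k + 1)))) / (k + 1)! : ℝ)))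
            ≤ nI * errTerm S ρ₁ ρ₂ ρ₃ ρ₄ A b t := by
  -- §a  free-field / order constants
  have hd' : (0 : ℝ) < d := by exact_mod_cast hd
  have hκ0 : 0 ≤ κ := hκ.le
  have hρ₃0 : 0 ≤ ρ₃ := le_trans (by positivity) hρ₃
  have hρ31 : 0 ≤ ρ₃ + 1 := by linarith
  have hs1 : 0 ≤ s1Const D D d κ := s1Const_nonneg D D d hκ0
  have hΓ0 : 0 ≤ (γ ^ (d + 1))⁻¹ := by positivity
  have hΓ1 : 1 ≤ (γ ^ (d + 1))⁻¹ := one_le_inv_iff₀.mpr ⟨pow_pos hγ0 _, pow_le_one₀ hγ0.le hγ1⟩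
  have h8 : 0 ≤ 8 * s1Const D D d κ * (γ ^ (d + 1))⁻¹ ^ D * 2 ^ d := by positivity
  have hρ₄1 : 1 ≤ ρ₄ := by linarith
  have hρ₄v : 8 * s1Const D D d κ * (γ ^ (d + 1))⁻¹ ^ D * 2 ^ d ≤ ρ₄ := by linarith
  have hC00 : 0 ≤ freeCov d α β 0 0 :=
    (condCov_freeCov_nonneg_le hα hβ ∅ 0 0).1.trans (condCov_freeCov_nonneg_le hα hβ ∅ 0 0).2
  have hθ0 : 0 < 2 * (d : ℝ) / (2 * d + α ^ 2) := by positivity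
  have hθ1 : 2 * (d : ℝ) / (2 * d + α ^ 2) < 1 := by
    rw [div_lt_one (by positivity)]
    nlinarith [pow_pos hα 2]
  have hL₀ : 0 < Real.log ((2 * d + α ^ 2) / (2 * d)) := by
    apply Real.log_pos
    rw [lt_div_iff₀ (by positivity)]
    nlinarith [pow_pos hα 2]
  have hlogθ : -Real.log (2 * (d : ℝ) / (2 * d + α ^ 2)) = Real.log ((2 * d + α ^ 2) / (2 * d)) := by
    rw [← Real.log_inv, inv_div]
  -- §b  the rate `δ`
  obtain ⟨δ, hδ, hδle, hres⟩ : ∃ δ : ℝ, 0 < δ ∧ δ ≤ Real.log ((2 * d + α ^ 2) / (2 * d)) ∧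
      0 < κ / 2 - δ / 2 * ((D : ℝ) ^ 2 * Real.sqrt d) := by
    refine ⟨min (Real.log ((2 * d + α ^ 2) / (2 * d))) (κ / ((D : ℝ) ^ 2 * Real.sqrt d + 1)), lt_min hL₀ (by positivity),
      min_le_left _ _, ?_⟩
    set X : ℝ := (D : ℝ) ^ 2 * Real.sqrt d with hX
    have hX0 : 0 ≤ X := by positivity
    have h1 : min (Real.log ((2 * d + α ^ 2) / (2 * d))) (κ / (X + 1)) ≤ κ / (X + 1) := min_le_right _ _
    have h2 : κ / (X + 1) * X < κ := by
      have h3 : κ / (X + 1) * X = κ * (X / (X + 1)) := by ring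
      rw [h3]
      exact mul_lt_of_lt_one_right hκ ((div_lt_one (by positivity)).mpr (by linarith))
    nlinarith [mul_le_mul_of_nonneg_right h1 hX0]
  have hδ0 : 0 ≤ δ := hδ.le
  have hκ'0 : 0 ≤ κ / 2 - δ / 2 * ((D : ℝ) ^ 2 * Real.sqrt d) := hres.le
  -- §c  the corridor multiplier `M` and the regime threshold `b₀`
  obtain ⟨M, hM0, hMκ, hMκ', hMδ, hML, hMe⟩ := exists_M_upper hρ31 hκ hres hδ hL₀ t
  have hMθ : ρ₃ + 1 ≤ -Real.log (2 * (d : ℝ) / (2 * d + α ^ 2)) * M := by rw [hlogθ]; exact hML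
  obtain ⟨b₀, hb₀0, hb₀fit⟩ : ∃ b₀ : ℝ, 0 ≤ b₀ ∧ (10 * ((d : ℝ) + 1) * (M + 1)) ^ 2 ≤ b₀ := ⟨_, by positivity, le_rfl⟩
  -- §d  the witnesses `S` (by unification at the very end) and `δ`
  refine ⟨?S, δ, ?hS, hδ, hδle, hres, fun b hb => ?main⟩
  case main =>
    obtain ⟨L, V, hb1, hL2b, hL1, hsmall, hfar, hV1, hVreg, hfit⟩ := params_upper (d := d) hM0 hb₀fit (lt_of_le_of_lt hbs hb)
    have hb0 : 0 ≤ b := by linarith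
    have hΓb : 1 ≤ (γ ^ (d + 1))⁻¹ * b := one_le_mul_of_one_le_of_one_le hΓ1 hb1
    have hWreg : b₀ ≤ b → M * b ^ (3 / 2 : ℝ) ≤ ((2 * V : ℕ) : ℝ) := fun h => (hVreg h).trans (by push_cast; linarith)
    have hWVreg : b₀ ≤ b → M * b ^ (3 / 2 : ℝ) ≤ ((2 * V - V : ℕ) : ℝ) := by
      rw [show 2 * V - V = V by omega]; exact hVreg
    refine ⟨L, 2 * V, V, lt_of_succ_mul_le hd (by omega) hfit, hfit, by omega, by omega, hb1, hsmall, hfar,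
      fun s nI A hnI hA => ?_⟩
    have hnI0 : 0 ≤ nI := by linarith
    -- §e  cut-off facts on the upper chain (`c_n = b/γ^{n+1}`, next box `γ·c_n`, both in `[b, γ^{−(d+1)}b]`)
    have hcut := fun n (hn : n ∈ Finset.range (d + 1)) => cutoff_upper (d := d) hγ0 hγ1 hb1 hn
    have hvw : V ≤ 2 * V := by omega
    -- §f  STRUCTURAL atoms (module 2, §6)
    have T1 := fun n (hn : n ∈ Finset.range (d + 1)) =>
      struct₁_le (s := s) (D := D) (d := d) (t := t) (ρ₁ := ρ₁) (ρ₂ := ρ₂) (hκ := hκ0) (hA := hA) (hb := hb1) (hΓ := hΓ0) (hc := (hcut n hn).2.2.2.1)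
        (hcb := (hcut n hn).2.2.2.2) (hb₀ := hb₀0) (hρ₃ := hρ₃0) (hρ₄ := hρ₄1) (hN0 := hnI0) (hNle := le_refl nI) (hreg := hWreg) (hM := hMκ)
    have T2 := fun n (hn : n ∈ Finset.range (d + 1)) =>
      struct₂_le (s := s) (D := D) (d := d) (t := t) (ρ₁ := ρ₁) (ρ₂ := ρ₂) (hκ := hκ0) (hA := hA) (hb := hb1) (hΓ := hΓ0) (hc := (hcut n hn).1) (hcb := (hcut n hn).2.1)
        (hL := hL2b) (hvw := hvw) (hb₀ := hb₀0) (hρ₃ := hρ₃0) (hρ₄ := hρ₄1) (hnI := hnI0) (hN0 := mul_nonneg hnI0 (pow_nonneg (Nat.cast_nonneg L) d))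
        (hNle := le_refl (nI * ((L : ℕ) : ℝ) ^ d)) (hN'0 := hnI0) (hN'le := le_refl nI) (hreg := hVreg) (hM := hMκ)
    -- §g  PER-BOX atoms (module 1, §4) at the cut-off `c_n`
    have R := fun n (hn : n ∈ Finset.range (d + 1)) =>
      errPB_remainder_le (t := t) (s := s) (D := D) (d := d) (ρ₃ := ρ₃) (hκ := hκ0) (hA := hA) (hb := hb1) (hΓ := hΓ0) (hc := (hcut n hn).1)
        (hcb := (hcut n hn).2.1) (hL := hL2b) (hρ₁ := hρ₁) (hρ₂ := hρ₂)
    have Vol := fun n (hn : n ∈ Finset.range (d + 1)) =>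
      errPB_volume_le (s := s) (D := D) (d := d) (hκ := hκ0) (hA := hA) (hb := hb1) (hΓ := hΓ0) (hc := (hcut n hn).1) (hcb := (hcut n hn).2.1)
        (hL := hL2b) (hγ' := one_pos) (hγc := (hcut n hn).2.2.1) (hρ₃ := hρ₃) (hρ₄ := hρ₄v)
    have Eps := fun n (hn : n ∈ Finset.range (d + 1)) (k : ℕ) =>
      errPB_eps_le (s := s) (D := D) (d := d) (hκ := hκ0) (hA := hA) (hb := hb1) (hΓ := hΓ0) (hc := (hcut n hn).1) (hcb := (hcut n hn).2.1)
        (hL := hL2b) (hb₀ := hb₀0) (hρ₃ := hρ₃0) (hρ₄ := hρ₄1) (hreg := hVreg) (hM := hMκ) k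
    have Chi := fun n (hn : n ∈ Finset.range (d + 1)) (k : ℕ) =>
      errPB_chi_le (s := s) (D := D) (d := d) (α := α) (c₀ := (freeCov d α β 0 0).toNNReal) (hκ := hκ0) (hA := hA) (hb := hb1) (hΓ := hΓ0)
        (hΓb := hΓb) (hc := (hcut n hn).1) (hcb := (hcut n hn).2.1) (hL1 := hL1) (hL := hL2b) (hγ0 := hγ0.le) (hγ1 := hγ1) (hγ' := one_pos)
        (hγc := (hcut n hn).2.2.1) (hρ₃ := hρ₃0) (hρ₄ := hρ₄1) k
    have D29 := fun n (hn : n ∈ Finset.range (d + 1)) (k : ℕ) =>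
      errPB_d29_le (s := s) (D := D) (d := d) (α := α) (C00 := freeCov d α β 0 0) (hA := hA) (hb := hb1) (hΓ := hΓ0) (hc := (hcut n hn).1)
        (hcb := (hcut n hn).2.1) (hL := hL2b) (hγ1 := hγ1) (hδ := hδ0) (hκ' := hκ'0) (hb₀ := hb₀0) (hρ₃ := hρ₃0) (hρ₄ := hρ₄1) (hreg := hVreg)
        (hM := hMδ) k
    have D31 := fun n (hn : n ∈ Finset.range (d + 1)) (k : ℕ) =>
      errPB_d31_le (s := s) (D := D) (d := d) (α := α) (hκ := hκ0) (hA := hA) (hb := hb1) (hΓ := hΓ0) (hc := (hcut n hn).1) (hcb := (hcut n hn).2.1)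
        (hL1 := hL1) (hL := hL2b) (hγ0 := hγ0.le) (hγ1 := hγ1) (hβ := hβ.le) (hC00 := hC00) (hθ0 := hθ0) (hθ1 := hθ1) (hb₀ := hb₀0) (hρ₃ := hρ₃0)
        (hρ₄ := hρ₄1) (hreg := hWVreg) (hM := hMθ) k
    -- the `k`-sum of the per-box error and the whole per-box error `Err_n ≤ Cr·FST + (Cv + T)·SND`
    have KS := fun n (hn : n ∈ Finset.range (d + 1)) =>
      (Finset.sum_le_sum fun k (_ : k ∈ Finset.range t) =>
        (div_le_div_of_nonneg_right
          (add_le_add (add_le_add (Eps n hn k)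
            (mul_le_mul_of_nonneg_left (add_le_add (Chi n hn k) (D29 n hn k)) (pow_nonneg (by norm_num : (0 : ℝ) ≤ 3) (k + 1))))
            (mul_le_mul_of_nonneg_left (add_le_add (Chi n hn k) (D31 n hn k)) (pow_nonneg (by norm_num : (0 : ℝ) ≤ 3) (k + 1))))
          (Nat.cast_nonneg (k + 1)!)).trans_eq (three_div_eq _ _ _ _ _ _ _ _ _)).trans_eq (Finset.sum_mul _ _ _).symm
    have T3 := fun n (hn : n ∈ Finset.range (d + 1)) =>
      mul_le_mul_of_nonneg_left ((add_le_add (add_le_add (R n hn) (Vol n hn)) (KS n hn)).trans_eq (err_shape_eq _ _ _ _ _)) hnI0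
    -- §h  CUMULANT-SIDE atoms (module 2, §5): (a) (b) (c) (d)=(b) (e) (f)
    have Ca := fun (k : ℕ) =>
      cum_a_le (s := s) (D := D) (d := d) (t := t) (ρ₁ := ρ₁) (ρ₂ := ρ₂) (C00 := freeCov d α β 0 0) (hA := hA) (hb := hb1) (hL := hL2b) (hδ := hδ0) (hκ' := hκ'0) (hb₀ := hb₀0)
        (hρ₃ := hρ₃0) (hρ₄ := hρ₄1) (hN0 := hnI0) (hNle := le_refl nI) (hreg := hWreg) (hM := hMκ') k
    have Cb := fun (k : ℕ) =>
      cum_b_le (s := s) (D := D) (d := d) (t := t) (ρ₁ := ρ₁) (ρ₂ := ρ₂) (C00 := freeCov d α β 0 0) (hA := hA) (hb := hb1) (hL := hL2b) (hδ := hδ0) (hκ' := hκ'0) (hb₀ := hb₀0)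
        (hρ₃ := hρ₃0) (hρ₄ := hρ₄1) (hN0 := hnI0) (hNle := le_refl nI) (hreg := hVreg) (hM := hMκ') k
    have Cc := fun (k : ℕ) =>
      cum_c_le (s := s) (D := D) (d := d) (t := t) (ρ₁ := ρ₁) (ρ₂ := ρ₂) (C00 := freeCov d α β 0 0) (hA := hA) (hb := hb1) (hL := hL2b) (hδ := hδ0) (hκ' := hκ'0) (hb₀ := hb₀0)
        (hρ₃ := hρ₃0) (hρ₄ := hρ₄1) (hnI := hnI0) (hNle := le_refl (nI * ((L : ℕ) : ℝ) ^ d)) (hreg := hWreg) (hM := hMκ') k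
    have Ce := fun (k : ℕ) (hk : k ∈ Finset.range t) =>
      cum_e_le (s := s) (D := D) (d := d) (t := t) (ρ₁ := ρ₁) (ρ₂ := ρ₂) (C00 := freeCov d α β 0 0) (w := 2 * V) (hA := hA) (hb := hb1) (hL := hL2b) (hδ := hδ0) (hκ' := hκ'0) (hb₀ := hb₀0)
        (hρ₃ := hρ₃0) (hρ₄ := hρ₄1) (hN0 := hnI0) (hNle := le_refl nI) (hreg := hVreg) (hM := hMe k (Finset.mem_range.mp hk))
    have Cf := fun (k : ℕ) =>
      cum_f_le (s := s) (D := D) (d := d) (t := t) (ρ₁ := ρ₁) (ρ₂ := ρ₂) (C00 := freeCov d α β 0 0) (hA := hA) (hb := hb1) (hL := hL2b) (hδ := hδ0) (hκ' := hκ'0) (hb₀ := hb₀0)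
        (hρ₃ := hρ₃0) (hρ₄ := hρ₄1) (hN0 := hnI0) (hNle := le_refl nI) (hreg := hVreg) (hM := hMδ) k
    have T4 :=
      (Finset.sum_le_sum fun k (hk : k ∈ Finset.range t) =>
        (div_le_div_of_nonneg_right
          (add_le_add (add_le_add (add_le_add (add_le_add (Ca k) (reassoc_b (Cb k))) (add_le_add (Cc k) (reassoc_b (Cb k)))) (Ce k hk)) (Cf k))
          (Nat.cast_nonneg (k + 1)!)).trans_eq (six_errTerm_div_eq _ _ _ _ _ _ _ _ _ _ _ _ _ _ _)).trans_eq (sum_mul_errTerm_eq _ _ _ _ _ _ _ _ _ _)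
    -- §i  per step, then the `d + 1` steps, then the fold into `nI·errTerm S …`
    have hF := fun n (hn : n ∈ Finset.range (d + 1)) =>
      add_le_add (add_le_add (T1 n hn) (T2 n hn)) (add_le_add (T3 n hn) T4)
    have key := (Finset.sum_le_sum hF).trans ((Finset.sum_const _).le.trans (nsmul_shape_le_errTerm (t := t) hnI0 hA hb0))
    dsimp only
    exact key
  case hS => exact le_max_right _ _

end Upper

end Literature.MathematicalPhysics.QuantumFieldTheory.Balaban1983to89.B1Eq324BenfattoSect5LedgerDischargeUpper

end
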